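import Summits.QuantumFields.YangMills.Theorems.UnitScaleTiltAvgCurvGradRect
import Summits.QuantumFields.YangMills.Theorems.UnitScaleTiltAvgActionDefectIdentity
import Literature.MathematicalPhysics.QuantumFieldTheory.Balaban1983to89.T3AvgDivergenceSplit
import Literature.MathematicalPhysics.QuantumFieldTheory.Balaban1983to89.T3OneStepAveragingPlaquettes
import HarnessLib

/-!
# Route `UnitScaleTilt`, crux K1 child «MinimiserStabilityRegPr» (stmt-QuantumFields-19200): THE REGISTERED STUB `stub_avgCurvGrad`
# (located gap G-K1a-3a′, schema `T3AvgDivergenceSplit.AvgCurvGradAt`) PROVED — first-order regularity of the one-step (0.4) average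

Cell `ym3-torus` (HUMAN RULING D-0037, YM ladder rung R3), seat `ym3-torus-p1` gen 8 (UV side).  If the fine field has plaquettes `< a ≤ c`
and curvature covariant gradients `≤ b`, every backward covariant derivative of every plaquette field of `D_{K,K+1}U` is `≤ C₁b + C₂a²` with
`C₁ = L³`, `C₂ = 35000·L⁴`, `c = 1/(70L²)`.

THE PROOF.  §1 dictionary: the tree's `covDerivT 1`/`plaqFT` of `unitsField (toUField V)` ([Balaban1985RegularSpaces] (1.1)–(1.2) on the torus)
read as `U(z,ν)⁻¹·U(∂p(z))·U(z,ν) − U(∂p(z + e_ν))` in `M₂(ℂ)`, both orientations; transport through the level identification `fieldShift`.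
§2 at a coarse plaquette: helper 5 (`norm_plaqHol_avgFun_sub_mean_conj_rect_le`) writes both coarse plaquettes as block means of transported
`L × L` square holonomies up to `435t²` each; the coarse bond variable `Ū(c) = corr(c)·U(c)` is replaced by the straight transporter `U(c)` at cost
`2·6t·L²a` (`dist1_corr_le`); the conjugate rule of `UnitScaleTiltAvgCurvGradRect` moves the comparison to the block points at the cost of the
staircase loop `U(c)⁻¹Γ′[L e_ν]Γ⁻¹` (a closed word of length `≤ (d+2)L`, `LatticeWordStokes.dist1_holAt_le`: `≤ t`) times `|U(∂R) − 1| ≤ L²a`;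
what is left is the `L`-step covariant difference of the square holonomy, `≤ L³b + 4L⁴a²` (`covDiff_rect_steps_le`).  §3 the family: one descent
step is one (0.4) averaging read through `fieldShift` (`descendTo_succ`).

References: T. Bałaban, CMP 109 (1987) 249–301 [Balaban1987RG1] ((0.4) p.253); CMP 99 (1985) 75–102 [Balaban1985RegularSpaces] ((1.1)–(1.2) p.76);
CMP 98 (1985) 17–51 [Balaban1985Averaging] (Prop. 3 (122)–(123) p.36, the printed first-order statement for the averaging (15)).
-/

noncomputable section

open scoped BigOperators Matrix.Norms.L2Operator

namespace Summit.QuantumFields.YangMills.Theorems.AvgCurvGrad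

open Literature.MathematicalPhysics.QuantumFieldTheory.Balaban1983to89
open T4Continuum BlockAveraging AveragingRT B10Eq47AxialChi ExpMeanLog LatticeWordStokes BlockAveragingPlaquetteBound
open B10Eq27TorusAxialLog (holT holT_cons_true holT_cons_false holT_nil holT_toUField val_holT_unitsField holT_plaqWord_eq_plaqHol
  holT_plaqWord_swap toUField unitsField)
open B10Eq68TorusRegularity (plaqFT covDerivT)
open B7Prop1Explicit (plaqWord)
open B7Eq78Linearization (conjR conjR_apply)
open T3ContinuumYM3Torus T3LevelShift T3TiltDescent T3OneStepAveragingPlaquettes T3AvgDivergenceSplit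
open T3UnitLawDensityEML (ℰp)
open Summit.QuantumFields.YangMills.Theorems.AvgActionDefect (norm_mean_le holAt_walk_replicate walkEnd_replicate blockSite_shift
  norm_plaqHol_avgFun_sub_mean_conj_rect_le)
open Summit.QuantumFields.BalabanUV.T4Continuum.Spine.NE7 (walkEnd_emb_stairWord)

/-! ## §1 Dictionary: `covDerivT 1` of the plaquette field of an `SU(2)` configuration, both orientations; the level identification -/

section Dictionary

variable {P : Params} {s : ℕ}

/-- The bond variables of `unitsField (toUField V)` are the matrices of `V`. [folklore] -/
theorem val_unitsField_toUField (V : GaugeField P s (Matrix.specialUnitaryGroup (Fin 2) ℂ)) (b : PBond P s) :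
    ((unitsField (toUField V) b : (Matrix (Fin 2) (Fin 2) ℂ)ˣ) : Matrix (Fin 2) (Fin 2) ℂ) =
      ((V b : Matrix.specialUnitaryGroup (Fin 2) ℂ) : Matrix (Fin 2) (Fin 2) ℂ) := rfl

/-- … and so are their inverses. [folklore] -/
theorem val_unitsField_toUField_inv (V : GaugeField P s (Matrix.specialUnitaryGroup (Fin 2) ℂ)) (b : PBond P s) :
    (((unitsField (toUField V) b)⁻¹ : (Matrix (Fin 2) (Fin 2) ℂ)ˣ) : Matrix (Fin 2) (Fin 2) ℂ) =
      (((V b)⁻¹ : Matrix.specialUnitaryGroup (Fin 2) ℂ) : Matrix (Fin 2) (Fin 2) ℂ) := rfl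

/-- The plaquette field `plaqFT` of `unitsField (toUField V)` is the matrix of the `SU(2)` transport along the plaquette word. [folklore] -/
theorem plaqFT_toUField (V : GaugeField P s (Matrix.specialUnitaryGroup (Fin 2) ℂ)) (κ κ' : Fin P.d) (x : Site P s) :
    plaqFT (unitsField (toUField V)) κ κ' x = ((holT V x (plaqWord κ κ') : Matrix.specialUnitaryGroup (Fin 2) ℂ) : Matrix (Fin 2) (Fin 2) ℂ) := by
  unfold plaqFT
  rw [val_holT_unitsField, holT_toUField]
  rfl

/-- **[Balaban1985RegularSpaces] (1.1) FOR THE PLAQUETTE FIELD OF AN `SU(2)` CONFIGURATION, READ IN `M₂(ℂ)`** (positive orientation `κ < κ′`):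
`(D^{1*}_{V,ν}F_{κκ′})(z + e_ν) = V(z,ν)⁻¹·V(∂p_{κκ′}(z))·V(z,ν) − V(∂p_{κκ′}(z + e_ν))`. [cite: Balaban1985RegularSpaces, (1.1) p.76] -/
theorem covDerivT_plaqFT_shift_eq (V : GaugeField P s (Matrix.specialUnitaryGroup (Fin 2) ℂ)) (ν : Fin P.d) {κ κ' : Fin P.d} (h : κ < κ')
    (z : Site P s) :
    covDerivT 1 (unitsField (toUField V)) ν (plaqFT (unitsField (toUField V)) κ κ') (z.shift ν) =
      (((V ⟨z, ν⟩)⁻¹ * GaugeField.plaqHol V ⟨z, κ, κ', h⟩ * V ⟨z, ν⟩ : Matrix.specialUnitaryGroup (Fin 2) ℂ) : Matrix (Fin 2) (Fin 2) ℂ) -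
        ((GaugeField.plaqHol V ⟨z.shift ν, κ, κ', h⟩ : Matrix.specialUnitaryGroup (Fin 2) ℂ) : Matrix (Fin 2) (Fin 2) ℂ) := by
  unfold covDerivT
  rw [inv_one, one_smul, conjR_apply, inv_inv, Site.unshift_shift, plaqFT_toUField, plaqFT_toUField,
    holT_plaqWord_eq_plaqHol V ⟨z, κ, κ', h⟩, holT_plaqWord_eq_plaqHol V ⟨z.shift ν, κ, κ', h⟩, val_unitsField_toUField_inv,
    val_unitsField_toUField]
  rfl

/-- The same for the negative orientation `κ′ < κ`: the plaquette field is the inverse plaquette variable. [cite: Balaban1985RegularSpaces, (1.1) p.76] -/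
theorem covDerivT_plaqFT_shift_eq_inv (V : GaugeField P s (Matrix.specialUnitaryGroup (Fin 2) ℂ)) (ν : Fin P.d) {κ κ' : Fin P.d} (h : κ' < κ)
    (z : Site P s) :
    covDerivT 1 (unitsField (toUField V)) ν (plaqFT (unitsField (toUField V)) κ κ') (z.shift ν) =
      (((V ⟨z, ν⟩)⁻¹ * (GaugeField.plaqHol V ⟨z, κ', κ, h⟩)⁻¹ * V ⟨z, ν⟩ : Matrix.specialUnitaryGroup (Fin 2) ℂ) : Matrix (Fin 2) (Fin 2) ℂ) -
        (((GaugeField.plaqHol V ⟨z.shift ν, κ', κ, h⟩)⁻¹ : Matrix.specialUnitaryGroup (Fin 2) ℂ) : Matrix (Fin 2) (Fin 2) ℂ) := by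
  unfold covDerivT
  rw [inv_one, one_smul, conjR_apply, inv_inv, Site.unshift_shift, plaqFT_toUField, plaqFT_toUField, holT_plaqWord_swap,
    holT_plaqWord_swap V (z.shift ν), holT_plaqWord_eq_plaqHol V ⟨z, κ', κ, h⟩, holT_plaqWord_eq_plaqHol V ⟨z.shift ν, κ', κ, h⟩,
    val_unitsField_toUField_inv, val_unitsField_toUField]
  rfl

/-- Every site is `z + e_ν` for `z = x − e_ν`. [folklore] -/
theorem shift_unshift' (x : Site P s) (ν : Fin P.d) : (x.unshift ν).shift ν = x := by
  funext κ
  by_cases hκ : κ = ν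
  · subst hκ; simp [Site.shift, Site.unshift]
  · simp [Site.shift, Site.unshift, hκ]

end Dictionary

section LevelShift

variable {F : T3Family} {m K j m' K' j' : ℕ}

/-- Transports of `fieldShift h V` are transports of `V` from the identified base site. [cite: Balaban1987RG1, (0.1) p.251] -/
theorem holT_fieldShift {G : Type*} [GaugeGroup G] (h : (F.PP m K).sitesPerDir j = (F.PP m' K').sitesPerDir j')
    (V : GaugeField (F.PP m' K') j' G) (x : Site (F.PP m K) j) (w : List (Letter 3)) :
    holT (fieldShift h V) x w = holT V (siteShift h x) w := by
  rw [B10Eq27TorusAxialLog.holT_eq_holAt, B10Eq27TorusAxialLog.holT_eq_holAt, holAt_fieldShift, walk_siteShift]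

/-- **THE COVARIANT DERIVATIVE OF THE PLAQUETTE FIELD IS TRANSPORTED BY THE LEVEL IDENTIFICATION**: for an `SU(2)` configuration `V`,
`(D^{1*}F)[fieldShift h V](x) = (D^{1*}F)[V](siteShift h x)`. [cite: Balaban1987RG1, (0.1) p.251] -/
theorem covDerivT_plaqFT_fieldShift (h : (F.PP m K).sitesPerDir j = (F.PP m' K').sitesPerDir j')
    (V : GaugeField (F.PP m' K') j' (Matrix.specialUnitaryGroup (Fin 2) ℂ)) (ν κ κ' : Fin 3) (x : Site (F.PP m K) j) :
    covDerivT 1 (unitsField (toUField (fieldShift h V))) ν (plaqFT (unitsField (toUField (fieldShift h V))) κ κ') x =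
      covDerivT 1 (unitsField (toUField V)) ν (plaqFT (unitsField (toUField V)) κ κ') (siteShift h x) := by
  have hb : fieldShift h V ⟨x.unshift ν, ν⟩ = V ⟨(siteShift h x).unshift ν, ν⟩ := by
    rw [fieldShift_apply, ← siteShift_unshift]; rfl
  unfold covDerivT
  simp only [plaqFT_toUField, holT_fieldShift, siteShift_unshift, conjR_apply, val_unitsField_toUField_inv, inv_inv,
    val_unitsField_toUField, hb]
  rfl

end LevelShift

/-! ## §2 One coarse covariant difference of the averaged curvature -/

section Coarse

variable {P : Params} {j : ℕ}

open Summit.QuantumFields.YangMills.Theorems.AvgActionDefect (loopHol_eq)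

/-- `↑(g * h) = ↑g * ↑h`. [folklore] -/
private theorem coe_mul₂ (g h : Matrix.specialUnitaryGroup (Fin 2) ℂ) :
    ((g * h : Matrix.specialUnitaryGroup (Fin 2) ℂ) : Matrix (Fin 2) (Fin 2) ℂ) = (g : Matrix (Fin 2) (Fin 2) ℂ) * (h : Matrix (Fin 2) (Fin 2) ℂ) := rfl

/-- In the model, `dist1 g = ‖g − 1‖`. [folklore] -/
private theorem dist1_eq₂ (g : Matrix.specialUnitaryGroup (Fin 2) ℂ) : dist1 g = ‖(g : Matrix (Fin 2) (Fin 2) ℂ) - 1‖ := rfl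

/-- `δ₂ = 1/3`. [folklore] -/
private theorem deltaSU_two : deltaSU (Fin 2) = 1 / 3 := by
  rw [deltaSU, Fintype.card_fin, min_eq_left]
  have := Real.pi_gt_three
  push_cast
  linarith

/-- **ONE COARSE COVARIANT DIFFERENCE OF THE CURVATURE OF THE (0.4)-AVERAGED FIELD** (standing range `j + 1 ≤ m + K`, `SU(2)`, printed
`exp[mean log]`): if the fine field has plaquettes `< a` (`a ≥ 0`, `t := (((d+2)L)²/4)·a ≤ 1/10`) and the one-step covariant differences in
direction `ν` of its plaquette field in the plane `κ < κ′` are all `≤ b`, then for `Ū = avgFun ℰ U`, every coarse `y` and `c = ⟨y, ν⟩`: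
`‖Ū(c)⁻¹·Ū(∂p′(y))·Ū(c) − Ū(∂p′(y + e_ν))‖ ≤ L·(L·(L·(b + 2(La)a) + 2(La)(La))) + 14·t·(L·L·a) + 870·t²`. [cite: Balaban1987RG1, (0.4) p.253] -/
theorem covDiff_plaqHol_avgFun_le (hj : j + 1 ≤ P.m + P.K) {a b : ℝ} (ha : 0 ≤ a)
    {U : GaugeField P j (Matrix.specialUnitaryGroup (Fin 2) ℂ)} (hU : PlaqSmall a U)
    (ht : ((((P.d + 2) * P.L : ℕ) : ℝ) ^ 2 / 4) * a ≤ 1 / 10) {κ κ' : Fin P.d} (hκ : κ < κ') (ν : Fin P.d)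
    (hb : ∀ z : Site P j, ‖(((U ⟨z, ν⟩)⁻¹ * GaugeField.plaqHol U ⟨z, κ, κ', hκ⟩ * U ⟨z, ν⟩ : Matrix.specialUnitaryGroup (Fin 2) ℂ) :
        Matrix (Fin 2) (Fin 2) ℂ) - ((GaugeField.plaqHol U ⟨z.shift ν, κ, κ', hκ⟩ : Matrix.specialUnitaryGroup (Fin 2) ℂ) : Matrix (Fin 2) (Fin 2) ℂ)‖ ≤ b)
    (y : Site P (j + 1)) :
    ‖(((avgFun (expMeanLogSU (n := Fin 2)) U ⟨y, ν⟩)⁻¹ * GaugeField.plaqHol (avgFun (expMeanLogSU (n := Fin 2)) U) ⟨y, κ, κ', hκ⟩ *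
          avgFun (expMeanLogSU (n := Fin 2)) U ⟨y, ν⟩ : Matrix.specialUnitaryGroup (Fin 2) ℂ) : Matrix (Fin 2) (Fin 2) ℂ) -
        ((GaugeField.plaqHol (avgFun (expMeanLogSU (n := Fin 2)) U) ⟨y.shift ν, κ, κ', hκ⟩ : Matrix.specialUnitaryGroup (Fin 2) ℂ) :
          Matrix (Fin 2) (Fin 2) ℂ)‖ ≤
      P.L * (P.L * (P.L * (b + 2 * (P.L * a) * a) + 2 * (P.L * a) * (P.L * a))) +
        14 * (((((P.d + 2) * P.L : ℕ) : ℝ) ^ 2 / 4) * a) * (P.L * P.L * a) + 870 * (((((P.d + 2) * P.L : ℕ) : ℝ) ^ 2 / 4) * a) ^ 2 := by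
  -- notation and smallness
  set τ : ℝ := ((((P.d + 2) * P.L : ℕ) : ℝ) ^ 2 / 4) * a with hτ
  have hτ0 : 0 ≤ τ := by positivity
  have hδ : τ < deltaSU (Fin 2) := by rw [deltaSU_two]; linarith
  have hb0 : 0 ≤ b := (norm_nonneg _).trans (hb (emb y))
  have hL0 : (0 : ℝ) ≤ P.L := Nat.cast_nonneg _
  set V : GaugeField P (j + 1) (Matrix.specialUnitaryGroup (Fin 2) ℂ) := avgFun (expMeanLogSU (n := Fin 2)) U with hV
  set c : PBond P (j + 1) := ⟨y, ν⟩ with hc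
  -- the block means of helper 5 at `y` and `y + e_ν`
  set Q : Type := (Fin P.d → Fin P.L) × Equiv.Perm (Fin P.d)
  let T : Site P (j + 1) → Q → Matrix.specialUnitaryGroup (Fin 2) ℂ := fun w q =>
    holAt U (walk (emb w) (stairWord q.2 (off q.1))) * rect U (Site.blockSite w q.1) κ κ' P.L P.L *
      (holAt U (walk (emb w) (stairWord q.2 (off q.1))))⁻¹
  set My : Matrix (Fin 2) (Fin 2) ℂ := ((Fintype.card Q : ℂ))⁻¹ • ∑ q : Q, ((T y q : Matrix.specialUnitaryGroup (Fin 2) ℂ) : Matrix (Fin 2) (Fin 2) ℂ)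
    with hMy
  set My' : Matrix (Fin 2) (Fin 2) ℂ := ((Fintype.card Q : ℂ))⁻¹ •
    ∑ q : Q, ((T (y.shift ν) q : Matrix.specialUnitaryGroup (Fin 2) ℂ) : Matrix (Fin 2) (Fin 2) ℂ) with hMy'
  have hρ : ‖((GaugeField.plaqHol V ⟨y, κ, κ', hκ⟩ : Matrix.specialUnitaryGroup (Fin 2) ℂ) : Matrix (Fin 2) (Fin 2) ℂ) - My‖ ≤ 435 * τ ^ 2 :=
    norm_plaqHol_avgFun_sub_mean_conj_rect_le hj ha hU ht hδ ⟨y, κ, κ', hκ⟩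
  have hρ' : ‖((GaugeField.plaqHol V ⟨y.shift ν, κ, κ', hκ⟩ : Matrix.specialUnitaryGroup (Fin 2) ℂ) : Matrix (Fin 2) (Fin 2) ℂ) - My'‖ ≤
      435 * τ ^ 2 :=
    norm_plaqHol_avgFun_sub_mean_conj_rect_le hj ha hU ht hδ ⟨y.shift ν, κ, κ', hκ⟩
  -- the term-by-term bound
  have hplaq : ∀ w : Site P j, dist1 (rect U w κ κ' P.L P.L) ≤ P.L * P.L * a := fun w => dist1_rect_le_mul hU hκ w P.L P.L
  have hcorr : dist1 (corr (expMeanLogSU (n := Fin 2)) U c) ≤ 6 * τ := dist1_corr_le ha hU hδ c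
  have hterm : ∀ q : Q, ‖(((V c)⁻¹ * T y q * V c : Matrix.specialUnitaryGroup (Fin 2) ℂ) : Matrix (Fin 2) (Fin 2) ℂ) -
      ((T (y.shift ν) q : Matrix.specialUnitaryGroup (Fin 2) ℂ) : Matrix (Fin 2) (Fin 2) ℂ)‖ ≤
      P.L * (P.L * (P.L * (b + 2 * (P.L * a) * a) + 2 * (P.L * a) * (P.L * a))) + 2 * τ * (P.L * P.L * a) + 2 * (6 * τ) * (P.L * P.L * a) := by
    intro q
    obtain ⟨r, σ⟩ := q
    -- names
    set A : Matrix.specialUnitaryGroup (Fin 2) ℂ := axialAvg U c with hA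
    set E : Matrix.specialUnitaryGroup (Fin 2) ℂ := corr (expMeanLogSU (n := Fin 2)) U c with hE
    set S : Matrix.specialUnitaryGroup (Fin 2) ℂ := holAt U (walk (emb y) (stairWord σ (off r))) with hS
    set S' : Matrix.specialUnitaryGroup (Fin 2) ℂ := holAt U (walk (emb (y.shift ν)) (stairWord σ (off r))) with hS'
    set R : Matrix.specialUnitaryGroup (Fin 2) ℂ := rect U (Site.blockSite y r) κ κ' P.L P.L with hR
    set R' : Matrix.specialUnitaryGroup (Fin 2) ℂ := rect U (Site.blockSite (y.shift ν) r) κ κ' P.L P.L with hR'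
    set N : Matrix.specialUnitaryGroup (Fin 2) ℂ := rowProd U (Site.blockSite y r) ν P.L with hN
    have hVc : V c = E * A := rfl
    show ‖(((V c)⁻¹ * (S * R * S⁻¹) * V c : Matrix.specialUnitaryGroup (Fin 2) ℂ) : Matrix (Fin 2) (Fin 2) ℂ) -
        ((S' * R' * S'⁻¹ : Matrix.specialUnitaryGroup (Fin 2) ℂ) : Matrix (Fin 2) (Fin 2) ℂ)‖ ≤ _
    -- step A: replace `Ū(c) = corr·U(c)` by `U(c)`
    have hstepA : ‖(((V c)⁻¹ * (S * R * S⁻¹) * V c : Matrix.specialUnitaryGroup (Fin 2) ℂ) : Matrix (Fin 2) (Fin 2) ℂ) -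
        ((A⁻¹ * (S * R * S⁻¹) * A : Matrix.specialUnitaryGroup (Fin 2) ℂ) : Matrix (Fin 2) (Fin 2) ℂ)‖ ≤ 2 * (6 * τ) * (P.L * P.L * a) := by
      have hg : (V c)⁻¹ * (S * R * S⁻¹) * V c = A⁻¹ * (E⁻¹ * (S * R * S⁻¹) * E⁻¹⁻¹) * A := by rw [hVc]; group
      rw [hg, coe_mul₂ (A⁻¹ * (E⁻¹ * (S * R * S⁻¹) * E⁻¹⁻¹)) A, coe_mul₂ A⁻¹, coe_mul₂ (A⁻¹ * (S * R * S⁻¹)) A, coe_mul₂ A⁻¹ (S * R * S⁻¹)]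
      refine (norm_inv_conj_sub_le A _ _).trans ?_
      refine (norm_conj_sub_self_le E⁻¹ (S * R * S⁻¹)).trans ?_
      rw [GaugeGroup.dist1_inv, GaugeGroup.dist1_conj]
      exact mul_le_mul (mul_le_mul_of_nonneg_left hcorr (by norm_num)) (hplaq _) (GaugeGroup.dist1_nonneg _) (by positivity)
    -- step B: move to the block points; the staircase loop is the (0.4) loop variable `W_c(r, σ, σ)`
    have hloop : dist1 (S'⁻¹ * A⁻¹ * S * N) ≤ τ := by
      have hW : loopHol U c (r, σ, σ) = S * N * S'⁻¹ * A⁻¹ := loopHol_eq hj U c r σ σ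
      have hconj : S'⁻¹ * A⁻¹ * S * N = (S'⁻¹ * A⁻¹) * loopHol U c (r, σ, σ) * (S'⁻¹ * A⁻¹)⁻¹ := by rw [hW]; group
      rw [hconj, GaugeGroup.dist1_conj]
      exact dist1_loopHol_le ha hU c (r, σ, σ)
    have hR' : R' = rect U (shiftN (Site.blockSite y r) ν P.L) κ κ' P.L P.L := by rw [hR', blockSite_shift hj]
    have hsteps : ‖((N⁻¹ * R * N : Matrix.specialUnitaryGroup (Fin 2) ℂ) : Matrix (Fin 2) (Fin 2) ℂ) - (R' : Matrix (Fin 2) (Fin 2) ℂ)‖ ≤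
        P.L * (P.L * (P.L * (b + 2 * (P.L * a) * a) + 2 * (P.L * a) * (P.L * a))) := by
      rw [hR']
      exact covDiff_rect_steps_le ha hU hκ ν hb P.L P.L (Site.blockSite y r) P.L
    have hstepB : ‖((A⁻¹ * (S * R * S⁻¹) * A : Matrix.specialUnitaryGroup (Fin 2) ℂ) : Matrix (Fin 2) (Fin 2) ℂ) -
        ((S' * R' * S'⁻¹ : Matrix.specialUnitaryGroup (Fin 2) ℂ) : Matrix (Fin 2) (Fin 2) ℂ)‖ ≤
        P.L * (P.L * (P.L * (b + 2 * (P.L * a) * a) + 2 * (P.L * a) * (P.L * a))) + 2 * τ * (P.L * P.L * a) := by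
      refine (covDiff_conj_le A N S S' R R').trans (add_le_add hsteps ?_)
      exact mul_le_mul (mul_le_mul_of_nonneg_left hloop (by norm_num)) (hplaq _) (GaugeGroup.dist1_nonneg _) (by positivity)
    calc _ ≤ ‖(((V c)⁻¹ * (S * R * S⁻¹) * V c : Matrix.specialUnitaryGroup (Fin 2) ℂ) : Matrix (Fin 2) (Fin 2) ℂ) -
            ((A⁻¹ * (S * R * S⁻¹) * A : Matrix.specialUnitaryGroup (Fin 2) ℂ) : Matrix (Fin 2) (Fin 2) ℂ)‖ +
          ‖((A⁻¹ * (S * R * S⁻¹) * A : Matrix.specialUnitaryGroup (Fin 2) ℂ) : Matrix (Fin 2) (Fin 2) ℂ) -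
            ((S' * R' * S'⁻¹ : Matrix.specialUnitaryGroup (Fin 2) ℂ) : Matrix (Fin 2) (Fin 2) ℂ)‖ := norm_sub_le_norm_sub_add_norm_sub _ _ _
      _ ≤ _ := by linarith [hstepA, hstepB]
  -- the mean of the transported block terms
  haveI : Nonempty Q := ⟨(fun _ => ⟨0, P.L_pos⟩, 1)⟩
  have hmean : ‖((V c)⁻¹ : Matrix.specialUnitaryGroup (Fin 2) ℂ) * My * (V c : Matrix (Fin 2) (Fin 2) ℂ) - My'‖ ≤
      P.L * (P.L * (P.L * (b + 2 * (P.L * a) * a) + 2 * (P.L * a) * (P.L * a))) + 2 * τ * (P.L * P.L * a) + 2 * (6 * τ) * (P.L * P.L * a) := by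
    have hlin : ((V c)⁻¹ : Matrix.specialUnitaryGroup (Fin 2) ℂ) * My * (V c : Matrix (Fin 2) (Fin 2) ℂ) - My' =
        ((Fintype.card Q : ℂ))⁻¹ • ∑ q : Q, ((((V c)⁻¹ * T y q * V c : Matrix.specialUnitaryGroup (Fin 2) ℂ) : Matrix (Fin 2) (Fin 2) ℂ) -
          ((T (y.shift ν) q : Matrix.specialUnitaryGroup (Fin 2) ℂ) : Matrix (Fin 2) (Fin 2) ℂ)) := by
      simp only [hMy, hMy', Finset.sum_sub_distrib, smul_sub, coe_mul₂, Finset.mul_sum, Finset.sum_mul, Matrix.mul_smul,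
        Matrix.smul_mul, Finset.smul_sum]
    rw [hlin]
    exact norm_mean_le hterm (by positivity)
  -- assemble
  have hsplit : (((V c)⁻¹ * GaugeField.plaqHol V ⟨y, κ, κ', hκ⟩ * V c : Matrix.specialUnitaryGroup (Fin 2) ℂ) : Matrix (Fin 2) (Fin 2) ℂ) -
      ((GaugeField.plaqHol V ⟨y.shift ν, κ, κ', hκ⟩ : Matrix.specialUnitaryGroup (Fin 2) ℂ) : Matrix (Fin 2) (Fin 2) ℂ) =
      (((V c)⁻¹ : Matrix.specialUnitaryGroup (Fin 2) ℂ) * My * (V c : Matrix (Fin 2) (Fin 2) ℂ) - My') +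
        ((((V c)⁻¹ : Matrix.specialUnitaryGroup (Fin 2) ℂ) : Matrix (Fin 2) (Fin 2) ℂ) *
            ((GaugeField.plaqHol V ⟨y, κ, κ', hκ⟩ : Matrix.specialUnitaryGroup (Fin 2) ℂ) : Matrix (Fin 2) (Fin 2) ℂ) * (V c : Matrix (Fin 2) (Fin 2) ℂ) -
          (((V c)⁻¹ : Matrix.specialUnitaryGroup (Fin 2) ℂ) : Matrix (Fin 2) (Fin 2) ℂ) * My * (V c : Matrix (Fin 2) (Fin 2) ℂ)) -
        (((GaugeField.plaqHol V ⟨y.shift ν, κ, κ', hκ⟩ : Matrix.specialUnitaryGroup (Fin 2) ℂ) : Matrix (Fin 2) (Fin 2) ℂ) - My') := by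
    rw [coe_mul₂, coe_mul₂]
    abel
  rw [hsplit]
  have h2 := norm_inv_conj_sub_le (V c) ((GaugeField.plaqHol V ⟨y, κ, κ', hκ⟩ : Matrix.specialUnitaryGroup (Fin 2) ℂ) : Matrix (Fin 2) (Fin 2) ℂ) My
  calc _ ≤ ‖((V c)⁻¹ : Matrix.specialUnitaryGroup (Fin 2) ℂ) * My * (V c : Matrix (Fin 2) (Fin 2) ℂ) - My'‖ +
          ‖(((V c)⁻¹ : Matrix.specialUnitaryGroup (Fin 2) ℂ) : Matrix (Fin 2) (Fin 2) ℂ) *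
              ((GaugeField.plaqHol V ⟨y, κ, κ', hκ⟩ : Matrix.specialUnitaryGroup (Fin 2) ℂ) : Matrix (Fin 2) (Fin 2) ℂ) * (V c : Matrix (Fin 2) (Fin 2) ℂ) -
            (((V c)⁻¹ : Matrix.specialUnitaryGroup (Fin 2) ℂ) : Matrix (Fin 2) (Fin 2) ℂ) * My * (V c : Matrix (Fin 2) (Fin 2) ℂ)‖ +
          ‖((GaugeField.plaqHol V ⟨y.shift ν, κ, κ', hκ⟩ : Matrix.specialUnitaryGroup (Fin 2) ℂ) : Matrix (Fin 2) (Fin 2) ℂ) - My'‖ :=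
        norm_sub_le_of_le (norm_add_le _ _) le_rfl
    _ ≤ (P.L * (P.L * (P.L * (b + 2 * (P.L * a) * a) + 2 * (P.L * a) * (P.L * a))) + 2 * τ * (P.L * P.L * a) + 2 * (6 * τ) * (P.L * P.L * a)) +
          435 * τ ^ 2 + 435 * τ ^ 2 := add_le_add (add_le_add hmean (h2.trans hρ)) hρ'
    _ = _ := by ring

end Coarse

/-! ## §3 The `d = 3` family: the schema `AvgCurvGradAt` and the registered stub -/

section T3

/-- **G-K1a-3a′ FOR THE FAMILY, EXPLICIT CONSTANTS**: `AvgCurvGradAt L (L³) (35000·L⁴) (1/(70L²))` for `1 < L` — one descent step is one (0.4)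
averaging read through the level identification (`descendTo_succ`, `covDerivT_plaqFT_fieldShift`), both orientations of the coarse plaquette
field (§1), and §2 with `d = 3`, `t = 25L²a/4 ≤ 5/56`. [cite: Balaban1985Averaging, Prop. 3 (122)-(123) p.36] -/
theorem avgCurvGradAt (L : ℕ) (hL : 1 < L) : AvgCurvGradAt L ((L : ℝ) ^ 3) (35000 * (L : ℝ) ^ 4) (1 / (70 * (L : ℝ) ^ 2)) := by
  intro F hFL K a b ha hac hb U hU hcov x ν κ κ' hκκ'
  subst hFL
  have hL1 : (1 : ℝ) < F.L := by exact_mod_cast hL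
  have hL0 : (0 : ℝ) < F.L := by linarith
  have hj : 0 + 1 ≤ (F.P (K + 1)).m + (F.P (K + 1)).K := by show 0 + 1 ≤ F.m + (K + 1); omega
  -- the smallness threshold
  have hLa : (F.L : ℝ) ^ 2 * a ≤ 1 / 70 := by
    calc (F.L : ℝ) ^ 2 * a ≤ (F.L : ℝ) ^ 2 * (1 / (70 * (F.L : ℝ) ^ 2)) := mul_le_mul_of_nonneg_left hac (sq_nonneg _)
      _ = 1 / 70 := by field_simp
  have hτ : ((((3 + 2) * F.L : ℕ) : ℝ) ^ 2 / 4) * a = 25 / 4 * ((F.L : ℝ) ^ 2 * a) := by push_cast; ring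
  have ht : ((((3 + 2) * F.L : ℕ) : ℝ) ^ 2 / 4) * a ≤ 1 / 10 := by rw [hτ]; linarith
  -- the fine hypothesis in the form of §2, both orientations
  have hbfine : ∀ {μ μ' : Fin 3} (hμ : μ < μ') (ν' : Fin 3) (z : Site (F.P (K + 1)) 0),
      ‖(((U ⟨z, ν'⟩)⁻¹ * GaugeField.plaqHol U ⟨z, μ, μ', hμ⟩ * U ⟨z, ν'⟩ : Matrix.specialUnitaryGroup (Fin 2) ℂ) : Matrix (Fin 2) (Fin 2) ℂ) -
        ((GaugeField.plaqHol U ⟨z.shift ν', μ, μ', hμ⟩ : Matrix.specialUnitaryGroup (Fin 2) ℂ) : Matrix (Fin 2) (Fin 2) ℂ)‖ ≤ b := by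
    intro μ μ' hμ ν' z
    have h := hcov (z.shift ν') ν' μ μ' (ne_of_lt hμ)
    rwa [covDerivT_plaqFT_shift_eq U ν' hμ z] at h
  -- one descent step = one (0.4) averaging, read through `fieldShift`
  rw [descendTo_succ]
  have hfs : covDerivT 1 (unitsField (toUField (fieldShift (F.sitesPerDir_eq (m := F.m) (K := K) (j := 0) (m' := F.m) (K' := K + 1) (j' := 1)
      (by omega)) ((BlockAveraging.blockAvg (P := F.PP F.m (K + 1)) (j := 0) ℰp).avg U)))) ν
      (plaqFT (unitsField (toUField (fieldShift (F.sitesPerDir_eq (m := F.m) (K := K) (j := 0) (m' := F.m) (K' := K + 1) (j' := 1)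
        (by omega)) ((BlockAveraging.blockAvg (P := F.PP F.m (K + 1)) (j := 0) ℰp).avg U)))) κ κ') x =
      covDerivT 1 (unitsField (toUField (avgFun (expMeanLogSU (n := Fin 2)) (P := F.P (K + 1)) (j := 0) U))) ν
        (plaqFT (unitsField (toUField (avgFun (expMeanLogSU (n := Fin 2)) (P := F.P (K + 1)) (j := 0) U))) κ κ')
        (siteShift (F.sitesPerDir_eq (m := F.m) (K := K) (j := 0) (m' := F.m) (K' := K + 1) (j' := 1) (by omega)) x) :=
    covDerivT_plaqFT_fieldShift _ _ _ _ _ _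
  refine (congrArg (fun M : Matrix (Fin 2) (Fin 2) ℂ => ‖M‖) hfs).trans_le ?_
  set y : Site (F.P (K + 1)) (0 + 1) := siteShift (F.sitesPerDir_eq (m := F.m) (K := K) (j := 0) (m' := F.m) (K' := K + 1) (j' := 1) (by omega)) x
    with hy
  -- the §2 bound and its numerical form
  have hmain : ∀ {μ μ' : Fin 3} (hμ : μ < μ'),
      ‖(((avgFun (expMeanLogSU (n := Fin 2)) U ⟨y.unshift ν, ν⟩)⁻¹ *
            GaugeField.plaqHol (avgFun (expMeanLogSU (n := Fin 2)) U) ⟨y.unshift ν, μ, μ', hμ⟩ *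
            avgFun (expMeanLogSU (n := Fin 2)) U ⟨y.unshift ν, ν⟩ : Matrix.specialUnitaryGroup (Fin 2) ℂ) : Matrix (Fin 2) (Fin 2) ℂ) -
          ((GaugeField.plaqHol (avgFun (expMeanLogSU (n := Fin 2)) U) ⟨(y.unshift ν).shift ν, μ, μ', hμ⟩ : Matrix.specialUnitaryGroup (Fin 2) ℂ) :
            Matrix (Fin 2) (Fin 2) ℂ)‖ ≤ (F.L : ℝ) ^ 3 * b + 35000 * (F.L : ℝ) ^ 4 * a ^ 2 := by
    intro μ μ' hμ
    have h := covDiff_plaqHol_avgFun_le (P := F.P (K + 1)) hj ha hU ht hμ ν (hbfine hμ ν) (y.unshift ν)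
    refine h.trans ?_
    change (F.L : ℝ) * ((F.L : ℝ) * ((F.L : ℝ) * (b + 2 * ((F.L : ℝ) * a) * a) + 2 * ((F.L : ℝ) * a) * ((F.L : ℝ) * a))) +
        14 * (((((3 + 2) * F.L : ℕ) : ℝ) ^ 2 / 4) * a) * ((F.L : ℝ) * (F.L : ℝ) * a) +
        870 * (((((3 + 2) * F.L : ℕ) : ℝ) ^ 2 / 4) * a) ^ 2 ≤
      (F.L : ℝ) ^ 3 * b + 35000 * (F.L : ℝ) ^ 4 * a ^ 2
    rw [hτ]
    have h3 : (F.L : ℝ) ^ 3 ≤ (F.L : ℝ) ^ 4 := pow_le_pow_right₀ hL1.le (by norm_num)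
    nlinarith [mul_nonneg (sub_nonneg.mpr h3) (sq_nonneg a), pow_nonneg hL0.le 4, sq_nonneg a,
      mul_nonneg (pow_nonneg hL0.le 4) (sq_nonneg a)]
  rcases lt_or_gt_of_ne hκκ' with hlt | hgt
  · have e1 := covDerivT_plaqFT_shift_eq (avgFun (expMeanLogSU (n := Fin 2)) (P := F.P (K + 1)) (j := 0) U) ν hlt (y.unshift ν)
    rw [← shift_unshift' y ν]
    refine (congrArg (fun M : Matrix (Fin 2) (Fin 2) ℂ => ‖M‖) e1).trans_le ?_
    exact hmain hlt
  · have e1 := covDerivT_plaqFT_shift_eq_inv (avgFun (expMeanLogSU (n := Fin 2)) (P := F.P (K + 1)) (j := 0) U) ν hgt (y.unshift ν)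
    rw [← shift_unshift' y ν]
    refine (congrArg (fun M : Matrix (Fin 2) (Fin 2) ℂ => ‖M‖) e1).trans_le ?_
    exact (covDiff_inv_le _ _ _).trans (hmain hgt)

/-- **THE REGISTERED STUB `stub_avgCurvGrad` OF THE LAYER-4 v3b BIRTH OF «MinimiserStabilityRegPr» (stmt-QuantumFields-19200), PROVED**
(signature verbatim): for every `L` there are `C₁ ≥ 0`, `C₂ > 0`, `c > 0` with `AvgCurvGradAt L C₁ C₂ c` — `C₁ = L³`, `C₂ = 35000·L⁴`,
`c = 1/(70L²)` for `L > 1`; `(0, 1, 1)` for `L ≤ 1` (vacuous: every family has `1 < F.L`). [cite: Balaban1985Averaging, Prop. 3 (122)-(123) p.36] -/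
theorem stub_avgCurvGrad : ∀ (L : ℕ), ∃ C₁ C₂ c : ℝ, 0 ≤ C₁ ∧ 0 < C₂ ∧ 0 < c ∧ AvgCurvGradAt L C₁ C₂ c := by
  intro L
  by_cases hL : 1 < L
  · have hL0 : (0 : ℝ) < L := by exact_mod_cast (zero_lt_one.trans hL)
    exact ⟨(L : ℝ) ^ 3, 35000 * (L : ℝ) ^ 4, 1 / (70 * (L : ℝ) ^ 2), by positivity, by positivity, by positivity, avgCurvGradAt L hL⟩
  · exact ⟨0, 1, 1, le_rfl, one_pos, one_pos, fun F hFL => absurd (hFL ▸ F.hL.2) hL⟩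

end T3

end Summit.QuantumFields.YangMills.Theorems.AvgCurvGrad

end
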